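import Summits.BirchSwinnertonDyer.BirchSwinnertonDyer.Theorems.ResidualThetaTransportAtTwoThetaLayerLambdaCongruenceAtTwoWSideStabilization
import Summits.BirchSwinnertonDyer.BirchSwinnertonDyer.Theorems.ResidualThetaTransportAtTwoSignedMuVanishingAtTwoPlusCuspSpanFlat
import Summits.BirchSwinnertonDyer.BirchSwinnertonDyer.Theorems.ResidualThetaTransportAtTwoCuspSpanDefs
import Summits.BirchSwinnertonDyer.BirchSwinnertonDyer.Theorems.ResidualThetaTransportAtTwoThetaLayerLambdaCongruenceAtTwoTwoExclusion
import Summits.BirchSwinnertonDyer.BirchSwinnertonDyer.Theorems.ResidualThetaTransportAtTwoThetaLayerLambdaCongruenceAtTwoPlusManin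
import Summits.BirchSwinnertonDyer.BirchSwinnertonDyer.Theorems.ResidualThetaTransportAtTwoThetaLayerLambdaCongruenceAtTwoDepletedHeckeCurve
import Summits.BirchSwinnertonDyer.BirchSwinnertonDyer.Theorems.ResidualThetaTransportAtTwoThetaLayerLambdaCongruenceAtTwoCurveSymbolPrimitive
import Summits.BirchSwinnertonDyer.BirchSwinnertonDyer.Theorems.ResidualThetaTransportAtTwoResidualThetaMainConjectureAtTwoLayerMuReading
import HarnessLib

/-!
# Crux `ThetaLayerLambdaCongruenceAtTwo` (stmt-BirchSwinnertonDyer-20688, route ResidualThetaTransportAtTwo), line `birth`: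
# the `S₀`-free undepleted statement (PR₂) — hence (μ-W₁) and THE CRUX — from the route's curve-free spanning predicate
# `SignedMuAtTwo.CuspSpanEvenAtTwo N` (the research node of crux Kμ⁺'s analytic half); width seat bsd-wall-rtt-p3-w3 g4
# (`--supports stmt-BirchSwinnertonDyer-20688 --as helper`; closes nothing)

HONEST FRAMING. THEOREMS ONLY; `CuspSpanEvenAtTwo N` (rtt-p4 g5's `@[conjecture]` predicate, p595076: «the closed loops
`{0 → b/4^k}` span `ker(H₁(X₀(N); 𝔽₂) → Q_N ⊗ 𝔽₂)`», dual form) is a HYPOTHESIS everywhere; nothing about any curve or form is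
asserted; BSD is not proved by any of this.

WHAT. `…MuW1OfUndepleted` (p607312) reduced the only research stub (μ-W₁) of line `birth` — and with it the crux — to the
`S₀`-FREE statement (PR₂): «for the newform `f` of a habitat⁺ curve `W` there is an EVEN layer `n₁` and a `2`-power cusp
`γ^s/2^{n₁+2}` at which the undepleted `2`-adic rational plus symbol `[·]⁺_f` attains its maximum norm over `ℚ`»
(`μ(ϑ_{n₁}(f)) = 0` at one even layer in Pollack–Weston's cohomological normalisation).  This file proves (PR₂) at `(W, f)`
from rtt-p4 g5's curve-free spanning predicate `SignedMuAtTwo.CuspSpanEvenAtTwo N_W` (`…CuspSpanDefs`, p595076 — the named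
research node of crux Kμ⁺ `SignedMuVanishingAtTwoPlus`, stmt-BirchSwinnertonDyer-20689):

* §1 plumbing: a cusp value `[γ∞]⁺_f = re{∞, γ∞}_f/Ω⁺_f` is a half-integer `m_γ/2` (`re Λ_f = ℤ·Ω⁺_f/2`);
  `‖m/2‖₂ ≤ 2`, `‖algebraMap ℚ ℚ̄₂ q‖ = ‖q‖_{ℚ₂}`.
* §2 UPPER BOUND `norm_ratPlusSymbol_le_two`: on the habitat⁺ (`GoodSS W 2`, `a₂(W) = 0`) EVERY value has `‖[r]⁺_f‖₂ ≤ 2`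
  (`2[r]⁺_f ∈ ℤ₍₂₎` for all `r ∈ ℚ`, not only at `2`-power cusps): lead g3's T₂-EXCLUSION `mem_of_gamma0_invariant_of_heckeTwo`
  (`Φ` invariant under `Γ₀(N_W)` modulo the ball of radius `2` by Manin + §1, `T₂Φ = a₂Φ = 0`, `2 ∤ N_W`) run as a descending
  induction on the radius `2·2^j` from Manin's-trick boundedness (`CohomologicalPeriod.exists_norm_plusSymbolK_eq_max`).
* §3 (PR₂): `undepletedMax_of_cuspSpanEvenAtTwo` — LOWER bound = rtt-p4 g5's Theorem (R)
  `SignedMuAtTwo.exists_two_le_norm_ratPlusSymbol_of_cuspSpan` (under `CuspSpanEvenAtTwo N_W` some even-layer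
  `[5^s/2^{n+2}]⁺_f` has `|·|₂ ≥ 2`), UPPER bound = §2; and `undepletedMax_of_forall_cuspSpanEvenAtTwo` — (PR₂) for every
  habitat⁺ curve from `CuspSpanEvenAtTwo` at all odd levels (the binder consumed by `…MuW1OfUndepleted`).

CONSEQUENCE (composed in the sequel file once the farm has built `…MuW1OfUndepleted`): THE CRUX Kan⁺ ⟸ the six plus-line
facts + Deligne + `∀ odd N, CuspSpanEvenAtTwo N` — the SAME research node as Kμ⁺'s analytic half.

References: [Pollack2003] Conj. 6.3; [PollackWeston2011MT] §2.2, Rem. 4.2; [Manin1972] §1.5–1.7, Thm. 1.9;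
[CremonaAlgorithms1997] §2.8; [MazurTateTeitelbaum1986Invent] §I.8.
-/

noncomputable section

-- justification: the `Summit.BirchSwinnertonDyer.BirchSwinnertonDyer.…` path repeats a component (route-file convention)
set_option linter.dupNamespace false

open scoped Classical MatrixGroups

open CongruenceSubgroup Literature.NumberTheory.EllipticCurves Literature.NumberTheory.EllipticCurves.ModularForms

namespace Summit.BirchSwinnertonDyer.BirchSwinnertonDyer.Theorems.ThetaLayerLambdaCongruenceAtTwo

/-! ## §1. Cusp values of `[·]⁺_f` are half-integers; `2`-adic norms -/

section Plumbing

variable {N : ℕ} [NeZero N] (f : CuspForm (Gamma0 N) 2)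

/-- **A cusp value of the rational plus symbol is a half-integer**: for a normalised newform `f` with rational
coefficients and `γ = (a b; c d) ∈ Γ₀(N)` with `c ≠ 0`, `[a/c]⁺_f = [γ∞]⁺_f = re{∞, γ∞}_f/Ω⁺_f = m/2` with `m ∈ ℤ`
(`re Λ_f = ℤ·Ω⁺_f/2` by definition of `Ω⁺_f`; `…CuspSpanHecke.exists_int_re_cuspSymbol_eq`). [cite: CremonaAlgorithms1997, §2.8] -/
theorem exists_ratPlusSymbol_maninCusp_eq_half (hf : IsNewform0 f) (hQ : coeffField f = ⊥) (γ : Gamma0 N)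
    (hc : (γ : SL(2, ℤ)) 1 0 ≠ 0) :
    ∃ m : ℤ, ratPlusSymbol f ((((γ : SL(2, ℤ)) 0 0 : ℚ)) / (((γ : SL(2, ℤ)) 1 0 : ℚ))) = (m : ℚ) / 2 := by
  have hreal : ∀ n, (cuspCoeff f n).im = 0 := cuspCoeff_im_eq_zero_of_coeffField_eq_bot hQ
  have hΩ : plusPeriod f ≠ 0 := (IsNewform0.plusPeriod_pos_holds hf hQ).ne'
  obtain ⟨m, hm⟩ := SignedMuAtTwo.exists_int_re_cuspSymbol_eq f hΩ γ
  refine ⟨m, ?_⟩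
  have hcusp : cuspSymbol f γ = modularSymbol f ((((γ : SL(2, ℤ)) 0 0 : ℚ)) / (((γ : SL(2, ℤ)) 1 0 : ℚ))) := by
    unfold cuspSymbol
    rw [if_neg hc]
  apply Rat.cast_injective (α := ℝ)
  push_cast
  rw [ratCast_ratPlusSymbol_holds hf hQ, normalizedPlusSymbol, plusSymbol_eq_re_holds f hreal, Complex.ofReal_re,
    ← hcusp, hm]
  field_simp

/-- A half-integer has `2`-adic norm `≤ 2`. [folklore] -/
theorem norm_algebraMap_intCast_div_two_le (m : ℤ) : ‖algebraMap ℚ (PadicAlgCl 2) ((m : ℚ) / 2)‖ ≤ 2 := by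
  rw [map_div₀, map_intCast, map_ofNat, norm_div, ResidualThetaLayer.norm_two_padicAlgCl, div_inv_eq_mul]
  have hm : ‖(m : PadicAlgCl 2)‖ ≤ 1 := by
    rw [← map_intCast (algebraMap ℚ_[2] (PadicAlgCl 2)), PadicAlgCl.norm_extends]
    exact Padic.norm_int_le_one m
  linarith

/-- `‖algebraMap ℚ ℚ̄₂ q‖ = ‖(q : ℚ₂)‖`. [folklore] -/
theorem norm_algebraMap_rat_eq_norm_ratCast_padic (q : ℚ) : ‖algebraMap ℚ (PadicAlgCl 2) q‖ = ‖((q : ℚ) : ℚ_[2])‖ := by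
  rw [norm_algebraMap_rat_padicAlgCl, Padic.eq_padicNorm]

end Plumbing

/-! ## §2. Every value of `[·]⁺_f` has `2`-adic norm `≤ 2` on the habitat⁺ (T₂-exclusion, integral form) -/

section Upper

variable {W : WeierstrassCurve ℚ} [W.IsElliptic] [W.IsGloballyMinimal]

/-- The level of the habitat⁺ newform is odd. [folklore] -/
theorem odd_conductorNorm_of_goodSS (hss : Literature.NumberTheory.EllipticCurves.Rank1Residual.GoodSS W 2) :
    Odd (W.conductorNorm ℤ) := by
  rcases Nat.even_or_odd (W.conductorNorm ℤ) with h | h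
  · exact absurd (even_iff_two_dvd.mp h) (SignedMuAtTwo.not_two_dvd_conductorNorm_of_goodSS hss)
  · exact h

/-- **All values of the rational plus symbol of a habitat⁺ newform lie in `½ℤ₍₂₎`**: for `W` good supersingular at `2`
with `a₂(W) = 0` and its newform `f`, `‖[r]⁺_f‖₂ ≤ 2` for EVERY `r ∈ ℚ` — not only at the `2`-power cusps.  PROOF
(T₂-exclusion, lead g3's `mem_of_gamma0_invariant_of_heckeTwo`, integral form): `Φ = [·]⁺_f` read in `ℚ̄₂` is
`Γ₀(N_W)`-invariant modulo the ball of radius `2` (Manin: `Φ(γr) − Φ(r) = Φ(γ∞) = m_γ/2`, §1), killed by `T₂`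
(`a₂ = 0`, `2 ∤ N_W`), and bounded (Manin's trick); if `‖Φ‖ ≤ 2·2^{j+1}` then `2Φ` lies in the ball of radius `2·2^j`, so
T₂-exclusion gives `‖Φ‖ ≤ 2·2^j`; descend to `j = 0`. [cite: Manin1972, §1.5–1.7 and Thm. 1.9] [cite: CremonaAlgorithms1997, §2.8] -/
theorem norm_ratPlusSymbol_le_two [NeZero (W.conductorNorm ℤ)] {f : CuspForm (Gamma0 (W.conductorNorm ℤ)) 2}
    (hf : IsNewformOf W f) (hss : Literature.NumberTheory.EllipticCurves.Rank1Residual.GoodSS W 2)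
    (ha : W.frobeniusTrace 2 = 0) (r : ℚ) :
    ‖algebraMap ℚ (PadicAlgCl 2) (ratPlusSymbol f r)‖ ≤ 2 := by
  have hf0 : IsNewform0 f := hf.1
  have hQ : coeffField f = ⊥ := hf.coeffField_eq_bot
  have hΩf : IsPlusPeriod f (plusPeriod f : ℂ) := isPlusPeriod_plusPeriod hf0 hQ
  have hN : Odd (W.conductorNorm ℤ) := odd_conductorNorm_of_goodSS hss
  have h2N : ¬ 2 ∣ W.conductorNorm ℤ := SignedMuAtTwo.not_two_dvd_conductorNorm_of_goodSS hss
  obtain ⟨ι, hι, hιa⟩ := exists_embedding_of_isNewformOf hf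
  -- `T₂Φ = a₂Φ = 0`
  have hT2 : ∀ x : ℚ, (∑ j : Fin 2, algebraMap ℚ (PadicAlgCl 2) (ratPlusSymbol f ((x + j) / 2))) +
      algebraMap ℚ (PadicAlgCl 2) (ratPlusSymbol f (2 * x)) = 0 := by
    intro x
    have h := heckeRel_embPlusSymbol ι hf0 hΩf Nat.prime_two x
    simp only [hι, hιa, if_neg h2N, Nat.cast_ofNat] at h
    have ha2 : ((W.LFunction 2 : ℤ) : PadicAlgCl 2) = 0 := by
      rw [W.LFunction_apply_prime_eq_frobeniusTrace 2 hss.1, ha, Int.cast_zero]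
    rw [ha2, zero_mul, mul_inv_cancel₀ (two_ne_zero : (2 : PadicAlgCl 2) ≠ 0), one_mul] at h
    exact h.symm
  -- a crude bound (Manin's trick)
  obtain ⟨B, -, -, hBle, -⟩ := CohomologicalPeriod.exists_norm_plusSymbolK_eq_max hf0 ι hΩf
  simp only [hι] at hBle
  obtain ⟨j₀, hj₀⟩ := pow_unbounded_of_one_lt B (one_lt_two : (1 : ℝ) < 2)
  have hcrude : ∀ x : ℚ, ‖algebraMap ℚ (PadicAlgCl 2) (ratPlusSymbol f x)‖ ≤ 2 * 2 ^ j₀ := fun x ↦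
    (hBle x).trans (hj₀.le.trans (by linarith [pow_pos (two_pos : (0 : ℝ) < 2) j₀]))
  -- one descent step: `‖Φ‖ ≤ 2·2^(j+1)` ⟹ `‖Φ‖ ≤ 2·2^j`
  have step : ∀ j : ℕ, (∀ x : ℚ, ‖algebraMap ℚ (PadicAlgCl 2) (ratPlusSymbol f x)‖ ≤ 2 * 2 ^ (j + 1)) →
      ∀ x : ℚ, ‖algebraMap ℚ (PadicAlgCl 2) (ratPlusSymbol f x)‖ ≤ 2 * 2 ^ j := by
    intro j hj
    let S : AddSubgroup (PadicAlgCl 2) :=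
      { carrier := {z | ‖z‖ ≤ 2 * 2 ^ j}
        add_mem' := fun {x y} hx hy ↦ (IsUltrametricDist.norm_add_le_max x y).trans (max_le hx hy)
        zero_mem' := by simp
        neg_mem' := fun {x} hx ↦ by simpa using hx }
    have hS : ∀ z : PadicAlgCl 2, z ∈ S ↔ ‖z‖ ≤ 2 * 2 ^ j := fun z ↦ Iff.rfl
    have h1j : (2 : ℝ) ≤ 2 * 2 ^ j := by
      have : (1 : ℝ) ≤ 2 ^ j := one_le_pow₀ (by norm_num)
      linarith
    have h := mem_of_gamma0_invariant_of_heckeTwo hN (fun x ↦ algebraMap ℚ (PadicAlgCl 2) (ratPlusSymbol f x)) S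
      (fun γ x hx ↦ by
        have hM := map_ratPlusSymbol_gamma0_smul hf0 hQ (algebraMap ℚ (PadicAlgCl 2)) γ x hx
        simp only [] at hM
        rw [hM, add_sub_cancel_right]
        by_cases hc : (γ : SL(2, ℤ)) 1 0 = 0
        · rw [if_pos hc]; exact S.zero_mem
        · rw [if_neg hc]
          obtain ⟨m, hm⟩ := exists_ratPlusSymbol_maninCusp_eq_half f hf0 hQ γ hc
          rw [hS, hm]
          exact (norm_algebraMap_intCast_div_two_le m).trans h1j)
      (fun x ↦ by rw [hT2 x]; exact S.zero_mem)
      (fun y ↦ (hS _).mpr (by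
        rw [nsmul_eq_mul, Nat.cast_ofNat, norm_mul, ResidualThetaLayer.norm_two_padicAlgCl]
        have := hj y
        rw [pow_succ] at this
        nlinarith [norm_nonneg (algebraMap ℚ (PadicAlgCl 2) (ratPlusSymbol f y))]))
    intro x
    exact (hS _).mp (h x)
  -- descend from `j₀` to `0`
  have descend : ∀ j : ℕ, (∀ x : ℚ, ‖algebraMap ℚ (PadicAlgCl 2) (ratPlusSymbol f x)‖ ≤ 2 * 2 ^ j) →
      ∀ x : ℚ, ‖algebraMap ℚ (PadicAlgCl 2) (ratPlusSymbol f x)‖ ≤ 2 := by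
    intro j
    induction j with
    | zero => intro h x; simpa using h x
    | succ j ih => intro h; exact ih (step j h)
  exact descend j₀ hcrude r

end Upper

/-! ## §3. (PR₂) from `CuspSpanEvenAtTwo N_W`; (PR₂) for all habitat⁺ curves from `CuspSpanEvenAtTwo` at odd levels -/

section Main

variable {W : WeierstrassCurve ℚ} [W.IsElliptic] [W.IsGloballyMinimal]

/-- **(PR₂) at `(W, f)` from the curve-free spanning predicate at the level `N_W`.**  For `W` good supersingular at `2`
with `a₂(W) = 0` and its newform `f`: `SignedMuAtTwo.CuspSpanEvenAtTwo N_W` ⟹ there is an EVEN layer `n₁` and a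
`2`-power cusp `γ^s/2^{n₁+2}` at which the undepleted `2`-adic rational plus symbol attains its maximum norm over `ℚ`
(= `μ(ϑ_{n₁}(f)) = 0` at one even layer in Pollack–Weston's cohomological normalisation).  LOWER bound: rtt-p4 g5's
Theorem (R) `SignedMuAtTwo.exists_two_le_norm_ratPlusSymbol_of_cuspSpan` (some even-layer `[5^s/2^{n+2}]⁺_f` has
`|·|₂ ≥ 2`); UPPER bound: `norm_ratPlusSymbol_le_two` (§2).  `CuspSpanEvenAtTwo N_W` is a hypothesis (conjecture-grade,
kit-verified for all odd `N ≤ 2999` and all 147 habitat⁺ conductors — see `…CuspSpanDefs`); BSD is not proved by this.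
[cite: Pollack2003, Conj. 6.3 (μ^± = 0)] [cite: PollackWeston2011MT, Rem. 4.2.1] -/
theorem undepletedMax_of_cuspSpanEvenAtTwo [NeZero (W.conductorNorm ℤ)] {f : CuspForm (Gamma0 (W.conductorNorm ℤ)) 2}
    (hf : IsNewformOf W f) (hss : Literature.NumberTheory.EllipticCurves.Rank1Residual.GoodSS W 2)
    (ha : W.frobeniusTrace 2 = 0) (hG : SignedMuAtTwo.CuspSpanEvenAtTwo (W.conductorNorm ℤ)) :
    ∃ n₁ : ℕ, Even n₁ ∧ ∃ s : ZMod (2 ^ n₁), ∀ r : ℚ, ‖algebraMap ℚ (PadicAlgCl 2) (ratPlusSymbol f r)‖ ≤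
      ‖algebraMap ℚ (PadicAlgCl 2) (ratPlusSymbol f ((((Literature.NumberTheory.EllipticCurves.cyclotomicGenerator 2 : ZMod (2 ^ (n₁ + 2))) ^ s.val).val : ℚ) / (2 : ℚ) ^ (n₁ + 2)))‖ := by
  have hf0 : IsNewform0 f := hf.1
  have hQ : coeffField f = ⊥ := hf.coeffField_eq_bot
  have h2N : ¬ 2 ∣ W.conductorNorm ℤ := SignedMuAtTwo.not_two_dvd_conductorNorm_of_goodSS hss
  have ha2 : cuspCoeff f 2 = 0 := by
    rw [hf.2 2, W.LFunction_apply_prime_eq_frobeniusTrace 2 hss.1, ha, Int.cast_zero]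
  obtain ⟨n, hn, s, h2le⟩ := SignedMuAtTwo.exists_two_le_norm_ratPlusSymbol_of_cuspSpan f hf0 hQ h2N ha2 hG
  refine ⟨n, hn, s, fun r ↦ (norm_ratPlusSymbol_le_two hf hss ha r).trans ?_⟩
  rw [norm_algebraMap_rat_eq_norm_ratCast_padic]
  exact h2le

/-- **(PR₂) on the whole habitat⁺ from `CuspSpanEvenAtTwo` at every odd level** — the binder shape consumed by
`curveDepletedSymbolMaxAtTwoPowerCusp_of_undepleted` / `thetaLayerLambdaCongruenceAtTwo_of_facts_undepletedMax_deligne`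
(`…MuW1OfUndepleted`) and the same research hypothesis as crux Kμ⁺'s `SignedMuAtTwo.flatMuZeroAtTwo_of_forall_cuspSpanEvenAtTwo`.
BSD is not proved by this. [cite: Pollack2003, Conj. 6.3 (μ^± = 0)] -/
theorem undepletedMax_of_forall_cuspSpanEvenAtTwo
    (hG : ∀ (N : ℕ) [NeZero N], ¬ 2 ∣ N → SignedMuAtTwo.CuspSpanEvenAtTwo N) :
    ∀ (W : WeierstrassCurve ℚ) [W.IsElliptic] [W.IsGloballyMinimal], ¬ W.HasCM → W.analyticRank = 0 → Literature.NumberTheory.EllipticCurves.Rank1Residual.GoodSS W 2 → W.frobeniusTrace 2 = 0 → W.Δ < 0 → ∀ [NeZero (W.conductorNorm ℤ)] (f : CuspForm (CongruenceSubgroup.Gamma0 (W.conductorNorm ℤ)) 2), Literature.NumberTheory.EllipticCurves.ModularForms.IsNewformOf W f → ∃ n₁ : ℕ, Even n₁ ∧ ∃ s : ZMod (2 ^ n₁), ∀ r : ℚ, ‖algebraMap ℚ (PadicAlgCl 2) (ratPlusSymbol f r)‖ ≤ ‖algebraMap ℚ (PadicAlgCl 2) (ratPlusSymbol f ((((Literature.NumberTheory.EllipticCurves.cyclotomicGenerator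 2 : ZMod (2 ^ (n₁ + 2))) ^ s.val).val : ℚ) / (2 : ℚ) ^ (n₁ + 2)))‖ := by
  intro W _ _ _ _ hss ha _ _ f hf
  exact undepletedMax_of_cuspSpanEvenAtTwo hf hss ha (hG _ (SignedMuAtTwo.not_two_dvd_conductorNorm_of_goodSS hss))

end Main

end Summit.BirchSwinnertonDyer.BirchSwinnertonDyer.Theorems.ThetaLayerLambdaCongruenceAtTwo

end
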